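import Summits.RiemannHypothesis.RiemannHypothesis.Theorems.WeilFormatCWindowDictionary
import Summits.RiemannHypothesis.RiemannHypothesis.Theorems.WeilFormatCWindowParity
import Summits.RiemannHypothesis.RiemannHypothesis.Theorems.WeilFormatCEntryBasis
import HarnessLib

/-!
# Format C (Fourier–Galerkin certificates of Weil positivity): the dictionary from SECTOR
  certificates (even / odd trigonometric windows) to `WeilPositivityOn a`

Helper file (`--supports stmt-RiemannHypothesis-0098`, lead-track anchor), RH-free. Seat
rh-explicit-weil-3 (gen3). Sequel of `WeilFormatCWindowDictionary.lean` (the dictionary) and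
`WeilFormatCWindowParity.lean` (parity-additivity of the window form); `sum_smul_chi_apply` is weil-2's
(`WeilFormatCEntryBasis.lean`).

Format-C certificates are produced per PARITY SECTOR (FORMATC-DESIGN §1: the sector Grams `G^σ`,
`σ ∈ {even, odd}`). Here:

* the trigonometric window `Σ_{|n| ≤ N} c_n χ_n` is a window function (measurable, `0` off `[-a,a]`,
  bounded by `Σ|c_n|(2a)^{-1/2}`, Lipschitz on the closed window with constant
  `Σ|c_n|(2a)^{-1/2}π|n|/a`), even (odd) when `c_{-n} = c_n` (`c_{-n} = −c_n`);
* `weilWindowForm_sum_chi_nonneg_of_sectors`: non-negativity of the window form on the even and on the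
  odd trigonometric windows gives it on all of them (split `c = c^{ev} + c^{od}`);
* **the sector dictionary** `weilPositivityOn_of_sector_nonneg`: if `weilWindowForm a (Σ c_n χ_n) ≥ 0`
  for all `N` and all EVEN `c`, and for all `N` and all ODD `c`, then `WeilPositivityOn a`.
-/

set_option autoImplicit false
set_option linter.dupNamespace false  -- the mandated namespace repeats `RiemannHypothesis`

noncomputable section

open Complex Filter Set MeasureTheory
open scoped Real Topology ComplexConjugate

namespace Summit.RiemannHypothesis.RiemannHypothesis.Theorems.WeilFormatC

open Literature.NumberTheory.LFunctions
open Literature.NumberTheory.LFunctions.Yoshida1992 (modes chi chiCore mem_modes)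

/-! ## Trigonometric windows: window-function properties and parity -/

section Trig

variable {a : ℝ}

/-- `χ_n(−x) = χ_{−n}(x)`. -/
theorem chi_neg_apply (a : ℝ) (n : ℤ) (x : ℝ) : chi a n (-x) = chi a (-n) x := by
  unfold chi chiCore
  by_cases hx : x ∈ Icc (-a) a
  · have hx' : -x ∈ Icc (-a) a := ⟨by linarith [hx.2], by linarith [hx.1]⟩
    rw [indicator_of_mem hx', indicator_of_mem hx]
    congr 1
    congr 1
    push_cast
    ring
  · have hx' : -x ∉ Icc (-a) a := fun h ↦ hx ⟨by linarith [h.2], by linarith [h.1]⟩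
    rw [indicator_of_notMem hx', indicator_of_notMem hx]

/-- Reflection of a trigonometric window: `(Σ_{|n|≤N} c_n χ_n)(−x) = Σ_{|n|≤N} c_{−n} χ_n(x)`. -/
theorem sum_smul_chi_neg_apply (N : ℕ) (c : ℤ → ℂ) (x : ℝ) :
    (∑ n ∈ modes N, c n • chi a n) (-x) = ∑ n ∈ modes N, c (-n) * chi a n x := by
  rw [sum_smul_chi_apply]
  simp_rw [chi_neg_apply]
  refine Finset.sum_equiv (Equiv.neg ℤ) (fun n ↦ ?_) (fun n _ ↦ ?_)
  · simp only [Equiv.neg_apply, mem_modes, abs_neg]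
  · simp only [Equiv.neg_apply, neg_neg]

/-- An even coefficient vector gives an even window. -/
theorem sum_smul_chi_even {N : ℕ} {c : ℤ → ℂ} (hc : ∀ n, c (-n) = c n) (x : ℝ) :
    (∑ n ∈ modes N, c n • chi a n) (-x) = (∑ n ∈ modes N, c n • chi a n) x := by
  rw [sum_smul_chi_neg_apply, sum_smul_chi_apply]
  simp_rw [hc]

/-- An odd coefficient vector gives an odd window. -/
theorem sum_smul_chi_odd {N : ℕ} {c : ℤ → ℂ} (hc : ∀ n, c (-n) = -c n) (x : ℝ) :
    (∑ n ∈ modes N, c n • chi a n) (-x) = -(∑ n ∈ modes N, c n • chi a n) x := by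
  rw [sum_smul_chi_neg_apply, sum_smul_chi_apply, ← Finset.sum_neg_distrib]
  simp_rw [hc, neg_mul]

/-- `χ_n` is measurable. -/
theorem measurable_chi (a : ℝ) (n : ℤ) : Measurable (chi a n) := by
  unfold chi
  exact (Yoshida1992.contDiff_chiCore a n).continuous.measurable.indicator measurableSet_Icc

/-- Trigonometric windows are measurable. -/
theorem measurable_sum_smul_chi (s : Finset ℤ) (c : ℤ → ℂ) :
    Measurable (∑ n ∈ s, c n • chi a n) := by
  have h : (∑ n ∈ s, c n • chi a n) = fun x ↦ ∑ n ∈ s, c n * chi a n x :=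
    funext (sum_smul_chi_apply s c)
  rw [h]
  exact Finset.measurable_sum s fun n _ ↦ measurable_const.mul (measurable_chi a n)

/-- Trigonometric windows vanish off `[-a, a]`. -/
theorem sum_smul_chi_eq_zero (s : Finset ℤ) (c : ℤ → ℂ) {x : ℝ} (hx : x ∉ Icc (-a) a) :
    (∑ n ∈ s, c n • chi a n) x = 0 := by
  rw [sum_smul_chi_apply]
  exact Finset.sum_eq_zero fun n _ ↦ by rw [chi, Set.indicator_of_notMem hx (chiCore a n), mul_zero]

/-- `‖χ_n(x)‖ ≤ (2a)^{-1/2}`. -/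
theorem norm_chi_le (a : ℝ) (n : ℤ) (x : ℝ) : ‖chi a n x‖ ≤ 1 / Real.sqrt (2 * a) := by
  unfold chi chiCore
  by_cases hx : x ∈ Icc (-a) a
  · rw [indicator_of_mem hx, norm_mul, Complex.norm_real,
      Real.norm_of_nonneg (by positivity : (0 : ℝ) ≤ 1 / Real.sqrt (2 * a))]
    have : ‖cexp (π * I * n * x / a)‖ = 1 := by
      rw [show (π * I * n * x / a : ℂ) = ((π * n * x / a : ℝ) : ℂ) * I by push_cast; ring,
        Complex.norm_exp_ofReal_mul_I]
    rw [this, mul_one]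
  · rw [indicator_of_notMem hx, norm_zero]
    positivity

/-- Trigonometric windows are bounded by `Σ |c_n| (2a)^{-1/2}`. -/
theorem norm_sum_smul_chi_le (s : Finset ℤ) (c : ℤ → ℂ) (x : ℝ) :
    ‖(∑ n ∈ s, c n • chi a n) x‖ ≤ ∑ n ∈ s, ‖c n‖ * (1 / Real.sqrt (2 * a)) := by
  rw [sum_smul_chi_apply]
  refine (norm_sum_le _ _).trans (Finset.sum_le_sum fun n _ ↦ ?_)
  rw [norm_mul]
  exact mul_le_mul_of_nonneg_left (norm_chi_le a n x) (norm_nonneg _)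

/-- `|e^{iθ} − e^{iθ'}| ≤ |θ − θ'|` for the window characters:
`‖χ_n(y) − χ_n(x)‖ ≤ (2a)^{-1/2} (π|n|/a) |y − x|` on the closed window (`a > 0`). -/
theorem norm_chi_sub_le (ha : 0 < a) (n : ℤ) {x y : ℝ} (hx : x ∈ Icc (-a) a) (hy : y ∈ Icc (-a) a) :
    ‖chi a n y - chi a n x‖ ≤ 1 / Real.sqrt (2 * a) * (π * |(n : ℝ)| / a) * |y - x| := by
  rw [chi, Set.indicator_of_mem hy (chiCore a n), Set.indicator_of_mem hx (chiCore a n)]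
  unfold chiCore
  rw [← mul_sub, norm_mul, Complex.norm_real,
    Real.norm_of_nonneg (by positivity : (0 : ℝ) ≤ 1 / Real.sqrt (2 * a)),
    mul_assoc (1 / Real.sqrt (2 * a)) (π * |(n : ℝ)| / a) |y - x|]
  refine mul_le_mul_of_nonneg_left ?_ (by positivity)
  -- ‖e^{iθy} − e^{iθx}‖ = ‖e^{iθx}‖ ‖e^{i(θy − θx)} − 1‖ ≤ |θ(y − x)|
  have hθ : ∀ z : ℝ, (π * I * n * z / a : ℂ) = I * ((π * n * z / a : ℝ) : ℂ) := fun z ↦ by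
    push_cast
    ring
  have key : cexp (π * I * n * y / a) - cexp (π * I * n * x / a) =
      cexp (π * I * n * x / a) * (cexp (I * ((π * n * (y - x) / a : ℝ) : ℂ)) - 1) := by
    rw [mul_sub, mul_one, ← Complex.exp_add]
    congr 2
    push_cast
    ring
  rw [key, norm_mul, hθ x, Complex.norm_exp_I_mul_ofReal, one_mul,
    Complex.norm_exp_I_mul_ofReal_sub_one, Real.norm_eq_abs, abs_mul, abs_two]
  calc 2 * |Real.sin (π * n * (y - x) / a / 2)| ≤ 2 * |π * n * (y - x) / a / 2| :=
        mul_le_mul_of_nonneg_left Real.abs_sin_le_abs zero_le_two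
    _ = π * |(n : ℝ)| / a * |y - x| := by
        rw [abs_div, abs_div, abs_mul, abs_mul, abs_of_pos Real.pi_pos, abs_of_pos ha, abs_two]
        ring

/-- Trigonometric windows are Lipschitz on the closed window with constant
`Σ |c_n| (2a)^{-1/2} (π|n|/a)` (`a > 0`). -/
theorem norm_sum_smul_chi_sub_le (ha : 0 < a) (s : Finset ℤ) (c : ℤ → ℂ) {x y : ℝ}
    (hx : x ∈ Icc (-a) a) (hy : y ∈ Icc (-a) a) :
    ‖(∑ n ∈ s, c n • chi a n) y - (∑ n ∈ s, c n • chi a n) x‖ ≤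
      (∑ n ∈ s, ‖c n‖ * (1 / Real.sqrt (2 * a) * (π * |(n : ℝ)| / a))) * |y - x| := by
  rw [sum_smul_chi_apply, sum_smul_chi_apply, ← Finset.sum_sub_distrib, Finset.sum_mul]
  refine (norm_sum_le _ _).trans (Finset.sum_le_sum fun n _ ↦ ?_)
  rw [← mul_sub, norm_mul, mul_assoc]
  exact mul_le_mul_of_nonneg_left (norm_chi_sub_le ha n hx hy) (norm_nonneg _)

end Trig

/-! ## The sector dictionary -/

section Sectors

variable {a : ℝ}

/-- **Sector certificates suffice.** If the window form is non-negative on every EVEN trigonometric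
window (`c_{-n} = c_n`) and on every ODD one (`c_{-n} = −c_n`), then it is non-negative on every
trigonometric window: split `c = c^{ev} + c^{od}` and use parity-additivity of the window form. -/
theorem weilWindowForm_sum_chi_nonneg_of_sectors (ha : 0 < a)
    (hev : ∀ (N : ℕ) (c : ℤ → ℂ), (∀ n, c (-n) = c n) →
      0 ≤ weilWindowForm a (∑ n ∈ modes N, c n • chi a n))
    (hod : ∀ (N : ℕ) (c : ℤ → ℂ), (∀ n, c (-n) = -c n) →
      0 ≤ weilWindowForm a (∑ n ∈ modes N, c n • chi a n))
    (N : ℕ) (c : ℤ → ℂ) : 0 ≤ weilWindowForm a (∑ n ∈ modes N, c n • chi a n) := by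
  set ce : ℤ → ℂ := fun n ↦ (c n + c (-n)) / 2 with hce
  set co : ℤ → ℂ := fun n ↦ (c n - c (-n)) / 2 with hco
  have hce' : ∀ n, ce (-n) = ce n := fun n ↦ by simp only [hce, neg_neg]; ring
  have hco' : ∀ n, co (-n) = -co n := fun n ↦ by simp only [hco, neg_neg]; ring
  have hsplit : (∑ n ∈ modes N, c n • chi a n) =
      (∑ n ∈ modes N, ce n • chi a n) + ∑ n ∈ modes N, co n • chi a n := by
    rw [← Finset.sum_add_distrib]
    refine Finset.sum_congr rfl fun n _ ↦ ?_
    rw [← add_smul]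
    congr 1
    simp only [hce, hco]
    ring
  rw [hsplit, weilWindowForm_add_of_even_odd ha.le (measurable_sum_smul_chi _ _)
    (fun x hx ↦ sum_smul_chi_eq_zero _ _ hx) (fun x ↦ norm_sum_smul_chi_le _ _ x)
    (fun x y hx hy ↦ norm_sum_smul_chi_sub_le ha _ _ hx hy) (measurable_sum_smul_chi _ _)
    (fun x hx ↦ sum_smul_chi_eq_zero _ _ hx) (fun x ↦ norm_sum_smul_chi_le _ _ x)
    (fun x y hx hy ↦ norm_sum_smul_chi_sub_le ha _ _ hx hy) (sum_smul_chi_even hce')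
    (sum_smul_chi_odd hco')]
  exact add_nonneg (hev N ce hce') (hod N co hco')

/-- **The sector dictionary (format C, per-parity certificates ⟹ a rung).** Let `a > 0`. If
`weilWindowForm a (Σ_{|n| ≤ N} c_n χ_n) ≥ 0` for every `N` and every EVEN coefficient vector, and for
every `N` and every ODD coefficient vector, then `WeilPositivityOn a`. -/
theorem weilPositivityOn_of_sector_nonneg (ha : 0 < a)
    (hev : ∀ (N : ℕ) (c : ℤ → ℂ), (∀ n, c (-n) = c n) →
      0 ≤ weilWindowForm a (∑ n ∈ modes N, c n • chi a n))
    (hod : ∀ (N : ℕ) (c : ℤ → ℂ), (∀ n, c (-n) = -c n) →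
      0 ≤ weilWindowForm a (∑ n ∈ modes N, c n • chi a n)) :
    WeilPositivityOn a :=
  weilPositivityOn_of_weilWindowForm_sum_chi_nonneg ha
    (weilWindowForm_sum_chi_nonneg_of_sectors ha hev hod)

end Sectors

end Summit.RiemannHypothesis.RiemannHypothesis.Theorems.WeilFormatC

end
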